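import Summits.ResolutionOfSingularities.ResolutionOfSingularities.Theorems.FrobeniusLadderFInjectiveMacaulayficationThreefoldOneBlowupFree
import Summits.ResolutionOfSingularities.ResolutionOfSingularities.Theorems.FrobeniusLadderFInjectiveMacaulayficationTrFullStepDoor
import Summits.ResolutionOfSingularities.ResolutionOfSingularities.Theorems.FrobeniusLadderFInjectiveMacaulayficationOfTrRungs
import Summits.ResolutionOfSingularities.ResolutionOfSingularities.Theorems.FrobeniusLadderFInjectiveMacaulayficationOfLocalDoorAdmFactOffClosed
import Summits.ResolutionOfSingularities.ResolutionOfSingularities.Theorems.FrobeniusLadderFInjectiveMacaulayficationDimSliceCM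
import Summits.ResolutionOfSingularities.ResolutionOfSingularities.Theorems.FrobeniusLadderFInjectiveMacaulayficationDimSliceOfCesnavicius
import Summits.ResolutionOfSingularities.ResolutionOfSingularities.Theorems.FrobeniusLadderFInjectiveMacaulayficationSingFullTower
import Summits.ResolutionOfSingularities.ResolutionOfSingularities.Theorems.CossartPiltant2019PrincipalizationHolds
import HarnessLib

/-!
# Q10 «FLATTENING-FREE DOOR TWIN», file B: the FULL-blow-up / TrOfResolutionFull / LocalDoor / TrFullStepDoor cascade without Raynaud–Gruson, and ★ the v41 door on TWO prints
# (crux `FInjectiveMacaulayfication` stmt-ResolutionOfSingularities-15315, chain w45a; res-L1-w45a-plan-1 RULING R21.6 (2) «Q10»; INPUTS-CP-v12 ADDENDUM 6 §1 (res-inputs-plan-2 g9);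
# seat res-L1-w45a-lead-1 g10, registrar)

[OURS · L1 W4.5a] Support file (`--supports stmt-ResolutionOfSingularities-15315 --as helper`); def-free; ZERO new mathematics — §1 consists of FLATTENING-FREE TWINS of landed theorems
(name = original ++ `F`; statement = original minus the hypothesis `(h081R : Stacks081R)`; proof = the original text, callees swapped to their twins from file A
`…ThreefoldOneBlowupFree` and from this file). §2 is the payoff. Nothing of the crux is proved; NO re-lettering of the registered door v41 `Lines/step_door.lean` 554affabf0e9e2f3
(pace rule R18.16) — the CHAIN records «conjunct .2.1 (`Stacks081R`) of `stub_namedFacts` discharged IN SUBSTANCE by the twin term, by name», as it did for F-77. AI-written (AI review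
is weaker than expert review).

* §1 twins (originals in parentheses): `exists_isBlowup_full_of_cm_of_rungs_of_FF` (`DimSliceCM.…`), `fullBlowupTr_of_cm_of_rungs_of_FF`, `tr_le_of_cesnaviciusOffClosed_of_F_of_resolutionFullF`,
  `stubTr_…F`, `fInjectiveMacaulayfication_of_cesnaviciusOffClosed_of_LFadmF_of_resolutionFullF` (`TrOfResolutionFull.…`), `fullBlowupGe4_of_localDoorAdmF`,
  `fInjectiveMacaulayfication_of_localDoorAdmF` (`OfLocalDoorAdm.…`), `fInjectiveMacaulayfication_of_localDoorAdm_of_factOffClosedF` (`OfLocalDoorAdmFactOffClosed.…`),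
  `fInjectiveMacaulayfication_of_trRungs_of_cesnaviciusOffClosedF` (`OfTrRungs.…`), `resolutionFullTr_of_cm_of_F_of_tStepF`, `resolutionFullTr_le_of_prints_of_F_of_tStepF`,
  `fInjectiveMacaulayfication_of_prints_of_LFadmF_of_tStepF`, `fInjectiveMacaulayfication_of_prints_of_LFadmF_of_tStepOneF` (`TrFullStepDoor.…`).
* §1b twins of the recipe-tower door terms `fInjectiveMacaulayfication_of_prints_of_tower_of_tStepOneF` (`IntrinsicTower.Recipes.…`), `fInjectiveMacaulayfication_of_prints_of_singTowersF` (`RegTower.…`);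
  §2 also `fInjectiveMacaulayfication_of_twoPrints_of_singTowers` (the HELD v44's door on two prints).
* §2 ★★ `fInjectiveMacaulayfication_of_twoPrints_of_LFadmF_of_tStepOne (hG : CossartPiltant2019General) (hM : CesnaviciusBlowupMacaulayficationOffClosed) (hLF : F-half) (hT1 : T″(·,·,1))`
  — THE v41 DOOR ON TWO PRINTED HYPOTHESES: Cossart–Piltant 2019 Thm 1.1 and Česnavičius 2021 Thm 5.3-(B). Cossart–Piltant 2019 Prop 4.4 (F-77) is the tree theorem
  `CP2008Prop44.CossartPiltant2019Principalization_holds`; Raynaud–Gruson (F-76, `Stacks081R`) is no longer a hypothesis (phantom, re-plumbed onto `Morphisms.exists_isBlowup_dominating`).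
  The dim ≤ 4 / ≤ 5 slices keep `h081R` for now (separate cascade through `DimSlice.fInjectiveMacaulayfication_dimLe_…`) — recorded honestly.
[cite: CossartPiltant2019, Thm. 1.1 (i)(ii); Prop. 4.4] [cite: Cesnavicius2021, Thm. 5.3] [cite: StacksProject, Tag 081T; Tag 080B] [cite: Temkin2008, Prop. 2.3.4; Lemma 2.1.4]
-/

-- single-problem summit: the doubled namespace component is forced
set_option linter.dupNamespace false

noncomputable section

open CategoryTheory CategoryTheory.Limits AlgebraicGeometry TopologicalSpace IsLocalRing Order
open Literature.AlgebraicGeometry.Resolution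

namespace Summit.ResolutionOfSingularities.ResolutionOfSingularities.Theorems.FInjectiveMacaulayfication.StacksFree

open Summit.ResolutionOfSingularities.ResolutionOfSingularities.Theorems.FInjectiveMacaulayfication
open SliceableCentre ClosedPointLocalResolutionAdm ClosedPointLocalResolutionAdmTr TrOfResolution TrOfResolutionFull ResolutionOfTr TrFull TrFullStep FTemkinClosedPoints
open DimSlice DimSliceCM OfLocalDoorAdm OfLocalDoorAdmFactOffClosed OfTrRungs TrFullStepDoor IntrinsicTower IntrinsicTower.Recipes RegTower

/-! ## §1 The cascade of flattening-free twins (proof texts of the originals; see the file header for the name map) -/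
/-- **A FULL blow-up model of every integral separated finite-type `n`-FOLD, `n ≥ 4`**, modulo {CP 1.1, 081R, CP 4.4} ∧ an abstract CM-CENTRE SUPPLIER `hCM` ∧
the closed-point rungs `4 … n − 1` ∧ the F-half AT LEVEL `n`. §1 supplies a model regular off finitely many closed points; the dimension-free F-Temkin engine
(`FTemkinClosedPointsAdm.full_model_of_regularOffFinite_of_localAdm`) finishes at the closed singular points with the pointwise CM/F split.
[OURS · conditional-result] [cite: Temkin2008, Prop. 2.3.4] [cite: CossartPiltant2019, Thm. 1.1; Prop. 4.4] [cite: Cesnavicius2021, Thm. 5.3] -/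
theorem exists_isBlowup_full_of_cm_of_rungs_of_FF
    (hG : CossartPiltant2019General.{0}) (hP : CossartPiltant2019Principalization.{0})
    (hCM : ∀ (p : ℕ), p.Prime → ∀ {k : Type} [Field k] [CharP k p] {X : Scheme.{0}} (f : X ⟶ Spec (.of k))
      [LocallyOfFiniteType f] [IsIntegral X] (x : X), ringKrullDim (X.presheaf.stalk x) ≠ 0 →
      ∀ (S' : Scheme.{0}) (g : S' ⟶ Spec (X.presheaf.stalk x)) (I : (Spec (X.presheaf.stalk x)).IdealSheafData),
        I ≠ ⊥ → IsBlowup g I → (∀ s : S', g.base s ≠ closedPoint (X.presheaf.stalk x) → s ∈ Scheme.regularLocus S') →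
        ∃ 𝓚 : S'.IdealSheafData, 𝓚 ≠ ⊥ ∧ (∀ s ∈ (𝓚.support : Set S'), g.base s = closedPoint (X.presheaf.stalk x)) ∧
          ∀ (S'' : Scheme.{0}) (π : S'' ⟶ S'), IsBlowup π 𝓚 → ∀ s : S'', IsDomain (S''.presheaf.stalk s) ∧ CMCl (S''.presheaf.stalk s))
    {n : ℕ} (h4 : 4 ≤ n) (p : ℕ) (hp : p.Prime)
    (hR : ∀ e r : ℕ, 4 ≤ e → e + 1 ≤ n → 1 ≤ r → ClosedPointLocalResolutionAdmTr p e r)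
    (hFn : ∀ (k : Type) [Field k] [CharP k p]
    (X : Scheme.{0}) (f : X ⟶ Spec (.of k)),
      IsSeparated f → LocallyOfFiniteType f → QuasiCompact f → IsIntegral X →
      ∀ x : X, IsClosed ({x} : Set X) → x ∉ Scheme.regularLocus X → ringKrullDim (X.presheaf.stalk x) = n →
      ∀ (S' : Scheme.{0}) (g : S' ⟶ Spec (X.presheaf.stalk x)) (I : (Spec (X.presheaf.stalk x)).IdealSheafData),
        I ≠ ⊥ → (I.support : Set (Spec (X.presheaf.stalk x))) ⊆ (Scheme.regularLocus (Spec (X.presheaf.stalk x)))ᶜ → IsBlowup g I →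
        (∀ s : S', g.base s ≠ closedPoint (X.presheaf.stalk x) → s ∈ Scheme.regularLocus S') →
        (∀ s : S', CMCl (S'.presheaf.stalk s)) →
        ∃ 𝓚 : S'.IdealSheafData, 𝓚 ≠ ⊥ ∧ (∀ s ∈ (𝓚.support : Set S'), g.base s = closedPoint (X.presheaf.stalk x)) ∧
          ∀ (S'' : Scheme.{0}) (π : S'' ⟶ S'), IsBlowup π 𝓚 →
            ∀ s : S'', FullCl p (S''.presheaf.stalk s))
    (k : Type) [Field k] [CharP k p] (X : Scheme.{0}) (f₀ : X ⟶ Spec (.of k))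
    [IsSeparated f₀] [LocallyOfFiniteType f₀] [QuasiCompact f₀] [IsIntegral X] (hn : topologicalKrullDim X = n) :
    ∃ (X'' : Scheme.{0}) (f'' : X'' ⟶ X) (J'' : X.IdealSheafData), IsBlowup f'' J'' ∧ J'' ≠ ⊥ ∧
      (J''.support : Set X) ⊆ (Scheme.regularLocus X)ᶜ ∧ ∀ x'' : X'', FullCl p (X''.presheaf.stalk x'') := by
  classical
  obtain ⟨X', f, J, F, hf, hJ, -, hF, hFcl, hreg⟩ := regularOffFinite_of_rungsF hG hP p k X f₀ hn (by omega) hR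
  refine FTemkinClosedPointsAdm.full_model_of_regularOffFinite_of_localAdm p hp k X f₀ ?_ X' f J hf hJ hF.toFinset
    (fun b hb => hFcl b (hF.mem_toFinset.mp hb)) (fun x' hx' => (Scheme.mem_regularLocus _).mp (hreg x' fun h => hx' (hF.mem_toFinset.mpr h)))
  intro b hbcl hbs S' g I hI hIadm hg hregS
  have hbn : ringKrullDim (X.presheaf.stalk b) = n := FTemkinClosedPoints.ringKrullDim_stalk_eq_of_isClosed f₀ hn b hbcl
  exact FInjectiveMacaulayficationDimFourSlice.exists_fullCentre_of_cmHalf_of_fHalf_at p f₀ b hbs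
    (fun S' g I hI hg hregS => hCM p hp f₀ b (by rw [hbn]; exact_mod_cast (show n ≠ 0 by omega)) S' g I hI hg hregS)
    (fun S' g I hI hIadm hg hregS hcm =>
      hFn k X f₀ inferInstance inferInstance inferInstance inferInstance b hbcl hbs hbn S' g I hI hIadm hg hregS hcm)
    S' g I hI hIadm hg hregS


/-- ★ **`FullBlowupTr p e r` (every `r`) ⟸ {CP 1.1, 081R, CP 4.4} ∧ a CM-centre supplier ∧ the rungs `T(p,e′,r′)` (`4 ≤ e′ < e`, `r′ ≥ 1`) ∧ the F-half AT
LEVEL `e`** (`4 ≤ e`): res-L1-w45a-stub-3's `DimSliceCM.exists_isBlowup_full_of_cm_of_rungs_of_F` over the field `k(X₁,…,X_r)`. [OURS · conditional-result]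
[cite: Temkin2008, Prop. 2.3.4] [cite: CossartPiltant2019, Thm. 1.1; Prop. 4.4] [cite: Cesnavicius2021, Thm. 5.3] -/
theorem fullBlowupTr_of_cm_of_rungs_of_FF
    (hG : CossartPiltant2019General.{0}) (hP : CossartPiltant2019Principalization.{0})
    (hCM : ∀ (p : ℕ), p.Prime → ∀ {k : Type} [Field k] [CharP k p] {X : Scheme.{0}} (f : X ⟶ Spec (.of k))
      [LocallyOfFiniteType f] [IsIntegral X] (x : X), ringKrullDim (X.presheaf.stalk x) ≠ 0 →
      ∀ (S' : Scheme.{0}) (g : S' ⟶ Spec (X.presheaf.stalk x)) (I : (Spec (X.presheaf.stalk x)).IdealSheafData),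
        I ≠ ⊥ → IsBlowup g I → (∀ s : S', g.base s ≠ closedPoint (X.presheaf.stalk x) → s ∈ Scheme.regularLocus S') →
        ∃ 𝓚 : S'.IdealSheafData, 𝓚 ≠ ⊥ ∧ (∀ s ∈ (𝓚.support : Set S'), g.base s = closedPoint (X.presheaf.stalk x)) ∧
          ∀ (S'' : Scheme.{0}) (π : S'' ⟶ S'), IsBlowup π 𝓚 → ∀ s : S'', IsDomain (S''.presheaf.stalk s) ∧ CMCl (S''.presheaf.stalk s))
    {p e : ℕ} (hp : p.Prime) (h4 : 4 ≤ e)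
    (hRlt : ∀ e' r' : ℕ, 4 ≤ e' → e' + 1 ≤ e → 1 ≤ r' → ClosedPointLocalResolutionAdmTr p e' r')
    (hFe : ∀ (k : Type) [Field k] [CharP k p] (X : Scheme.{0}) (f : X ⟶ Spec (.of k)),
      IsSeparated f → LocallyOfFiniteType f → QuasiCompact f → IsIntegral X →
      ∀ x : X, IsClosed ({x} : Set X) → x ∉ Scheme.regularLocus X → ringKrullDim (X.presheaf.stalk x) = e →
      ∀ (S' : Scheme.{0}) (g : S' ⟶ Spec (X.presheaf.stalk x)) (I : (Spec (X.presheaf.stalk x)).IdealSheafData),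
        I ≠ ⊥ → (I.support : Set (Spec (X.presheaf.stalk x))) ⊆ (Scheme.regularLocus (Spec (X.presheaf.stalk x)))ᶜ → IsBlowup g I →
        (∀ s : S', g.base s ≠ closedPoint (X.presheaf.stalk x) → s ∈ Scheme.regularLocus S') →
        (∀ s : S', CMCl (S'.presheaf.stalk s)) →
        ∃ 𝓚 : S'.IdealSheafData, 𝓚 ≠ ⊥ ∧ (∀ s ∈ (𝓚.support : Set S'), g.base s = closedPoint (X.presheaf.stalk x)) ∧
          ∀ (S'' : Scheme.{0}) (π : S'' ⟶ S'), IsBlowup π 𝓚 → ∀ s : S'', FullCl p (S''.presheaf.stalk s))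
    (r : ℕ) : FullBlowupTr p e r := by
  intro k _ _ Y g hs hl hq hi hd
  haveI := hs; haveI := hl; haveI := hq
  haveI := NonClosedPointChart.charP_fractionRing_mvPolynomial p k r
  exact exists_isBlowup_full_of_cm_of_rungs_of_FF hG hP hCM h4 p hp hRlt (fun k _ _ X f => hFe k X f) _ Y g hd


/-- ★★ **THE LEVEL-`e` RUNG FROM THE F-HALF AND RESOLUTION OF FULL VARIETIES** (strong induction on `e`): with {CP 1.1, 081R, CP 4.4, Česnavičius 5.3 (B)}
BY NAME, the F-half at the levels `4 … e` and `ResolutionFullTr p e′ r′` at the levels `4 ≤ e′ ≤ e` (`r′ ≥ 1`): `ClosedPointLocalResolutionAdmTr p e r` for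
every `r ≥ 1`. Step: T(p,e,r) ⟸ `ResolutionTr p e r` (`TrOfResolution`) ⟸ `FullBlowupTr p e r` (§3, fed by the induction hypothesis at the levels `< e`)
∧ `ResolutionFullTr p e r`. [OURS · conditional-result] [cite: Temkin2008, Prop. 2.3.4; Lemma 2.1.4] [cite: CossartPiltant2019, Thm. 1.1; Prop. 4.4]
[cite: Cesnavicius2021, Thm. 5.3] -/
theorem tr_le_of_cesnaviciusOffClosed_of_F_of_resolutionFullF (n : ℕ)
    (hG : CossartPiltant2019General.{0}) (hP : CossartPiltant2019Principalization.{0})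
    (hM : CesnaviciusBlowupMacaulayficationOffClosed.{0}) {p : ℕ} (hp : p.Prime)
    (hF : ∀ e : ℕ, 4 ≤ e → e ≤ n → ∀ (k : Type) [Field k] [CharP k p] (X : Scheme.{0}) (f : X ⟶ Spec (.of k)),
      IsSeparated f → LocallyOfFiniteType f → QuasiCompact f → IsIntegral X →
      ∀ x : X, IsClosed ({x} : Set X) → x ∉ Scheme.regularLocus X → ringKrullDim (X.presheaf.stalk x) = e →
      ∀ (S' : Scheme.{0}) (g : S' ⟶ Spec (X.presheaf.stalk x)) (I : (Spec (X.presheaf.stalk x)).IdealSheafData),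
        I ≠ ⊥ → (I.support : Set (Spec (X.presheaf.stalk x))) ⊆ (Scheme.regularLocus (Spec (X.presheaf.stalk x)))ᶜ → IsBlowup g I →
        (∀ s : S', g.base s ≠ closedPoint (X.presheaf.stalk x) → s ∈ Scheme.regularLocus S') →
        (∀ s : S', CMCl (S'.presheaf.stalk s)) →
        ∃ 𝓚 : S'.IdealSheafData, 𝓚 ≠ ⊥ ∧ (∀ s ∈ (𝓚.support : Set S'), g.base s = closedPoint (X.presheaf.stalk x)) ∧
          ∀ (S'' : Scheme.{0}) (π : S'' ⟶ S'), IsBlowup π 𝓚 → ∀ s : S'', FullCl p (S''.presheaf.stalk s))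
    (hRF : ∀ e r : ℕ, 4 ≤ e → e ≤ n → 1 ≤ r → ResolutionFullTr p e r) :
    ∀ e r : ℕ, 4 ≤ e → e ≤ n → 1 ≤ r → ClosedPointLocalResolutionAdmTr p e r := by
  intro e
  induction e using Nat.strong_induction_on with
  | _ e ih =>
    intro r h4 hen hr
    refine tr_of_fullBlowup_of_resolutionFull ?_ (hRF e r h4 hen hr)
    exact fullBlowupTr_of_cm_of_rungs_of_FF hG hP (DimSliceOfCesnavicius.cmSupplier_of_cesnaviciusOffClosed hM) hp h4
      (fun e' r' h4' hlt hr' => ih e' (by omega) r' h4' (by omega) hr') (hF e h4 hen) r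


/-- The ADMISSIBLE local door supplies the FULL blow-up model in dimension `≥ 4` (the input shape of `OfFullBlowupGe4`). [OURS · conditional-result]
[cite: Temkin2008, Prop. 2.3.4 (iii)] [cite: CossartPiltant2019, Thm. 1.1 (i)(ii); Prop. 4.4] -/
theorem fullBlowupGe4_of_localDoorAdmF
    (hG : CossartPiltant2019General.{0}) (hP : CossartPiltant2019Principalization.{0})
    (hLR : RegularOffFiniteOfLRAdm.LocalResolutionNonClosedGe4Adm) (hLF : LocalFullificationFibreAdmGe4.LocalFullificationFibreAdmGe4)
    (p : ℕ) (hp : p.Prime) :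
    ∀ (k : Type) [Field k] [CharP k p] (X : Scheme.{0}) (f : X ⟶ Spec (.of k)),
      IsSeparated f → LocallyOfFiniteType f → QuasiCompact f → IsIntegral X → (4 : WithBot ℕ∞) ≤ topologicalKrullDim X →
      ∃ (X'' : Scheme.{0}) (f'' : X'' ⟶ X) (J'' : X.IdealSheafData), IsBlowup f'' J'' ∧ J'' ≠ ⊥ ∧
        ∀ x'' : X'', FullCl p (X''.presheaf.stalk x'') := by
  intro k _ _ X f hs hl hq hi hd
  haveI := hs
  haveI := hl
  haveI := hq
  haveI := hi
  have h3 : (3 : WithBot ℕ∞) ≤ topologicalKrullDim X := le_trans (by norm_num) hd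
  obtain ⟨X'', f'', J'', hf'', hJ'', -, hfull⟩ :=
    FTemkinClosedPointsAdm.exists_isBlowup_full_of_LFadm_of_regularOffFinite (fun d h => hLF d h) p hp k X f hd
      (regularOffFinite_of_LRadmF hG hP hLR p hp k X f h3)
  exact ⟨X'', f'', J'', hf'', hJ'', hfull⟩


/-- **★★★ THE ROUTE DECL `Theses.FrobeniusLadder.FInjectiveMacaulayfication` FROM THE ADMISSIBLE LOCAL DOOR** {CP 1.1, 081R, CP 4.4} ∧ (LR_adm) ∧ (LF_adm)
— door v36.2's `_proof` term (registered stubs `stub_localResolutionNonClosedGe4Adm`, `stub_localFullificationFibreAdmGe4`). [OURS · conditional-result]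
[cite: CossartPiltant2019, Thm. 1.1 (i)(ii); Prop. 4.4] [cite: RaynaudGruson1971, Thm. 5.2.2] [cite: Temkin2008, Prop. 2.3.4 (iii)] -/
theorem fInjectiveMacaulayfication_of_localDoorAdmF
    (hG : CossartPiltant2019General.{0}) (hP : CossartPiltant2019Principalization.{0})
    (hLR : RegularOffFiniteOfLRAdm.LocalResolutionNonClosedGe4Adm) (hLF : LocalFullificationFibreAdmGe4.LocalFullificationFibreAdmGe4) :
    Summit.ResolutionOfSingularities.ResolutionOfSingularities.Theses.FrobeniusLadder.FInjectiveMacaulayfication :=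
  OfFullBlowupGe4.fInjectiveMacaulayfication_of_fullBlowupGe4 hG (fun p hp => fullBlowupGe4_of_localDoorAdmF hG hP hLR hLF p hp)


/-- **★ THE ROUTE DECL FROM {CP 1.1, 081R, CP 4.4} ∧ [Česnavičius 5.3, reading (B), as a binder] ∧ (LR_adm) ∧ (LF_adm-F)** — door v37's `_proof` term
under text (B). [OURS · conditional-result] [cite: Cesnavicius2021, Thm. 5.3] [cite: CossartPiltant2019, Thm. 1.1 (i)(ii); Prop. 4.4]
[cite: Temkin2008, Prop. 2.3.4 (iii)] -/
theorem fInjectiveMacaulayfication_of_localDoorAdm_of_factOffClosedF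
    (hG : CossartPiltant2019General.{0}) (hP : CossartPiltant2019Principalization.{0})
    (hM : ∀ (Y : Scheme.{0}) [IsIntegral Y] [IsNoetherian Y], Scheme.IsExcellent Y →
      ∀ W : Set Y, IsClosed W →
        (∀ y : Y, y ∉ W → ∀ d : ℕ, ringKrullDim (Y.presheaf.stalk y) = d →
            ∀ s : Fin d → Y.presheaf.stalk y, (Ideal.span (Set.range s)).radical.IsMaximal →
              RingTheory.Sequence.IsWeaklyRegular (Y.presheaf.stalk y) (List.ofFn s)) →
        ∃ Z : Y.IdealSheafData, (Z.support : Set Y) ⊆ W ∧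
          ∀ (Y' : Scheme.{0}) (π : Y' ⟶ Y), IsBlowup π Z →
            ∀ y' : Y', ∀ d : ℕ, ringKrullDim (Y'.presheaf.stalk y') = d →
              ∀ s : Fin d → Y'.presheaf.stalk y', (Ideal.span (Set.range s)).radical.IsMaximal →
                RingTheory.Sequence.IsWeaklyRegular (Y'.presheaf.stalk y') (List.ofFn s))
    (hLR : RegularOffFiniteOfLRAdm.LocalResolutionNonClosedGe4Adm)
    (hF : LocalFullificationFibreAdmGe4Split.LocalFInjectivizationFibreAdmGe4) :
    Summit.ResolutionOfSingularities.ResolutionOfSingularities.Theses.FrobeniusLadder.FInjectiveMacaulayfication :=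
  fInjectiveMacaulayfication_of_localDoorAdmF hG hP hLR
    (LocalMacaulayficationOfFactOffClosed.localFullificationFibreAdmGe4_of_factOffClosed_of_F hM hF)


/-- **★ THE ROUTE DECL ⟸ {CP 1.1, 081R, CP 4.4, Česnavičius 2021 Thm. 5.3 — reading (B), BY NAME} ∧ the transcendental-field rungs (all `e ≥ 4`, `r ≥ 1`)
∧ the F-half (LF_adm-F).** One line over res-L1-w45a-stub-2's `OfLocalDoorAdmFactOffClosed.fInjectiveMacaulayfication_of_localDoorAdm_of_factOffClosed`
(door v37's `_proof` term) and `localResolutionNonClosedGe4Adm_of_tr`. [OURS · conditional-result: conditional on four published theorems BY NAME and on the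
CANDIDATE rungs / F-half] [cite: Cesnavicius2021, Thm. 5.3] [cite: CossartPiltant2019, Thm. 1.1 (i)(ii); Prop. 4.4] [cite: RaynaudGruson1971, Thm. 5.2.2]
[cite: Temkin2008, Prop. 2.3.4 (iii)] -/
theorem fInjectiveMacaulayfication_of_trRungs_of_cesnaviciusOffClosedF
    (hG : CossartPiltant2019General.{0}) (hP : CossartPiltant2019Principalization.{0})
    (hM : CesnaviciusBlowupMacaulayficationOffClosed.{0})
    (hR : ∀ p e r : ℕ, p.Prime → 4 ≤ e → 1 ≤ r → ClosedPointLocalResolutionAdmTr p e r)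
    (hF : LocalFullificationFibreAdmGe4Split.LocalFInjectivizationFibreAdmGe4) :
    Summit.ResolutionOfSingularities.ResolutionOfSingularities.Theses.FrobeniusLadder.FInjectiveMacaulayfication :=
  fInjectiveMacaulayfication_of_localDoorAdm_of_factOffClosedF hG hP hM
    (localResolutionNonClosedGe4Adm_of_tr hR) hF


/-- ★★ **DOOR v38's RESOLUTION STUB ⟸ four published theorems ∧ the F-half ∧ resolution of FULL varieties over `k(X₁,…,X_r)`:**
`stub_closedPointLocalResolutionAdmTr` ⟸ {CP 1.1, 081R, CP 4.4, Česnavičius 5.3 (B)} ∧ `LocalFInjectivizationFibreAdmGe4` ∧ {ResolutionFullTr p e r}_{e ≥ 4, r ≥ 1}.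
[OURS · conditional-result] [cite: Temkin2008, Prop. 2.3.4; Lemma 2.1.4] [cite: CossartPiltant2019, Thm. 1.1; Prop. 4.4] [cite: Cesnavicius2021, Thm. 5.3] -/
theorem stubTr_of_cesnaviciusOffClosed_of_LFadmF_of_resolutionFullF
    (hG : CossartPiltant2019General.{0}) (hP : CossartPiltant2019Principalization.{0})
    (hM : CesnaviciusBlowupMacaulayficationOffClosed.{0})
    (hLF : LocalFullificationFibreAdmGe4Split.LocalFInjectivizationFibreAdmGe4)
    (hRF : ∀ p e r : ℕ, p.Prime → 4 ≤ e → 1 ≤ r → ResolutionFullTr p e r) :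
    ∀ p e r : ℕ, p.Prime → 4 ≤ e → 1 ≤ r → ClosedPointLocalResolutionAdmTr p e r :=
  fun p e r hp he hr => tr_le_of_cesnaviciusOffClosed_of_F_of_resolutionFullF e hG hP hM hp
    (fun e' h4 _ => hLF e' h4 p hp) (fun e' r' h4 _ hr' => hRF p e' r' hp h4 hr') e r he le_rfl hr


/-- ★★★ **THE ROUTE DECL ⟸ {CP 2019 Thm 1.1, Stacks 081R, CP 2019 Prop 4.4, Česnavičius 2021 Thm 5.3 (B)} BY NAME ∧ the F-half `LocalFInjectivizationFibreAdmGe4`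
∧ RESOLUTION OF FULL VARIETIES over `k(X₁,…,X_r)` (`e ≥ 4`, `r ≥ 1`)** — door v38's `_proof` term with the resolution stub pushed onto FULL (locally integral,
Cohen–Macaulay, F-injective) input only. [OURS · conditional-result: conditional on four published theorems BY NAME and on the CANDIDATE statements]
[cite: Cesnavicius2021, Thm. 5.3] [cite: CossartPiltant2019, Thm. 1.1 (i)(ii); Prop. 4.4] [cite: RaynaudGruson1971, Thm. 5.2.2] [cite: Temkin2008, Prop. 2.3.4] -/
theorem fInjectiveMacaulayfication_of_cesnaviciusOffClosed_of_LFadmF_of_resolutionFullF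
    (hG : CossartPiltant2019General.{0}) (hP : CossartPiltant2019Principalization.{0})
    (hM : CesnaviciusBlowupMacaulayficationOffClosed.{0})
    (hLF : LocalFullificationFibreAdmGe4Split.LocalFInjectivizationFibreAdmGe4)
    (hRF : ∀ p e r : ℕ, p.Prime → 4 ≤ e → 1 ≤ r → ResolutionFullTr p e r) :
    Summit.ResolutionOfSingularities.ResolutionOfSingularities.Theses.FrobeniusLadder.FInjectiveMacaulayfication :=
  fInjectiveMacaulayfication_of_trRungs_of_cesnaviciusOffClosedF hG hP hM
    (stubTr_of_cesnaviciusOffClosed_of_LFadmF_of_resolutionFullF hG hP hM hLF hRF) hLF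


/-- ★★ **`ResolutionFullTr p e r` ⟸ {CP 1.1, 081R, CP 4.4} ∧ a CM-centre supplier ∧ the rungs T(p,e′,r′) (`4 ≤ e′ < e`, `r′ ≥ 1`) ∧ F(e) ∧ T″(p,e,r)** (`e ≥ 4`) — Temkin's
induction on ONE FULL `e`-fold: `DimSlice.regularOffFinite_of_rungs` off the closed points, the pointwise triple composition at each bad closed point (its local ring is
FULL because `Y` is; its local dimension is `e`), `TrFullStep.admitsDesingularization_of_regularOffFinite_of_localCentre` to finish. [OURS · conditional-result]
[cite: Temkin2008, Prop. 2.3.4] [cite: CossartPiltant2019, Thm. 1.1 (i)(ii); Prop. 4.4] [cite: Cesnavicius2021, Thm. 5.3] -/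
theorem resolutionFullTr_of_cm_of_F_of_tStepF {p e r : ℕ} (h4 : 4 ≤ e)
    (hG : CossartPiltant2019General.{0}) (hP : CossartPiltant2019Principalization.{0})
    (hCM : ∀ (p : ℕ), p.Prime → ∀ {k : Type} [Field k] [CharP k p] {X : Scheme.{0}} (f : X ⟶ Spec (.of k))
      [LocallyOfFiniteType f] [IsIntegral X] (x : X), ringKrullDim (X.presheaf.stalk x) ≠ 0 →
      ∀ (S' : Scheme.{0}) (g : S' ⟶ Spec (X.presheaf.stalk x)) (I : (Spec (X.presheaf.stalk x)).IdealSheafData),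
        I ≠ ⊥ → IsBlowup g I → (∀ s : S', g.base s ≠ closedPoint (X.presheaf.stalk x) → s ∈ Scheme.regularLocus S') →
        ∃ 𝓚 : S'.IdealSheafData, 𝓚 ≠ ⊥ ∧ (∀ s ∈ (𝓚.support : Set S'), g.base s = closedPoint (X.presheaf.stalk x)) ∧
          ∀ (S'' : Scheme.{0}) (π : S'' ⟶ S'), IsBlowup π 𝓚 → ∀ s : S'', IsDomain (S''.presheaf.stalk s) ∧ CMCl (S''.presheaf.stalk s))
    (hp : p.Prime)
    (hRlt : ∀ e' r' : ℕ, 4 ≤ e' → e' + 1 ≤ e → 1 ≤ r' → ClosedPointLocalResolutionAdmTr p e' r')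
    (hFe : ∀ (k : Type) [Field k] [CharP k p] (X : Scheme.{0}) (f : X ⟶ Spec (.of k)),
      IsSeparated f → LocallyOfFiniteType f → QuasiCompact f → IsIntegral X →
      ∀ x : X, IsClosed ({x} : Set X) → x ∉ Scheme.regularLocus X → ringKrullDim (X.presheaf.stalk x) = e →
      ∀ (S' : Scheme.{0}) (g : S' ⟶ Spec (X.presheaf.stalk x)) (I : (Spec (X.presheaf.stalk x)).IdealSheafData),
        I ≠ ⊥ → (I.support : Set (Spec (X.presheaf.stalk x))) ⊆ (Scheme.regularLocus (Spec (X.presheaf.stalk x)))ᶜ → IsBlowup g I →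
        (∀ s : S', g.base s ≠ closedPoint (X.presheaf.stalk x) → s ∈ Scheme.regularLocus S') →
        (∀ s : S', CMCl (S'.presheaf.stalk s)) →
        ∃ 𝓚 : S'.IdealSheafData, 𝓚 ≠ ⊥ ∧ (∀ s ∈ (𝓚.support : Set S'), g.base s = closedPoint (X.presheaf.stalk x)) ∧
          ∀ (S'' : Scheme.{0}) (π : S'' ⟶ S'), IsBlowup π 𝓚 → ∀ s : S'', FullCl p (S''.presheaf.stalk s))
    (hT : LocalRegularizationFibreFullTr p e r) : ResolutionFullTr p e r := by
  classical
  intro k _ _ Y g hs hl hq hi hd hYfull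
  haveI := hs; haveI := hl; haveI := hq
  haveI := NonClosedPointChart.charP_fractionRing_mvPolynomial p k r
  obtain ⟨X', f, J, F, hf, hJ, -, hFfin, hFcl, hreg⟩ :=
    regularOffFinite_of_rungsF hG hP p _ Y g hd (by omega) hRlt
  refine admitsDesingularization_of_regularOffFinite_of_localCentre Y g (fun b hb hbs S' g' I hI hIadm hg' hregS => ?_) X' f J hf hJ hFfin.toFinset
    (fun b hb => hFcl b (hFfin.mem_toFinset.mp hb)) (fun x' hx' => hreg x' fun h => hx' (hFfin.mem_toFinset.mpr h))
  have hbe : ringKrullDim (Y.presheaf.stalk b) = e := ringKrullDim_stalk_eq_of_isClosed g hd b hb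
  refine exists_regularCentre_of_fullCentre_of_tStep_at p g b hbs ?_ ?_ S' g' I hI hIadm hg' hregS
  · -- FULL centres at `b`: the pointwise CM/F split (Česnavičius-(B) supplier ∧ F(e) at `b`)
    intro S₁ g₁ I₁ hI₁ hI₁adm hg₁ hreg₁
    exact FInjectiveMacaulayficationDimFourSlice.exists_fullCentre_of_cmHalf_of_fHalf_at p g b hbs
      (fun S₂ g₂ I₂ hI₂ hg₂ hreg₂ => hCM p hp g b (by rw [hbe]; exact_mod_cast (show e ≠ 0 by omega)) S₂ g₂ I₂ hI₂ hg₂ hreg₂)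
      (fun S₂ g₂ I₂ hI₂ hI₂adm hg₂ hreg₂ hcm₂ => hFe _ Y g hs hl hq hi b hb hbs hbe S₂ g₂ I₂ hI₂ hI₂adm hg₂ hreg₂ hcm₂)
      S₁ g₁ I₁ hI₁ hI₁adm hg₁ hreg₁
  · -- regular centres at `b` for FULL local blow-ups: T″ at the closed singular FULL point `b`
    intro S₁ g₁ I₁ hI₁ hI₁adm hg₁ hreg₁ hfull₁
    exact hT k Y g hs hl hq hi hd b hb hbs (hYfull b) S₁ g₁ I₁ hI₁ hI₁adm hg₁ hreg₁ hfull₁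


/-- ★★ **{ResolutionFullTr p e r}_{4 ≤ e ≤ n, r ≥ 1} ⟸ four prints ∧ {F(e)}_{4≤e≤n} ∧ {T″(p,e,r)}_{4≤e≤n, r≥1}** — strong induction on `n`; the lower T-levels needed by §1 come
back from the lower ResolutionFull-levels through the square (`tr_le_of_cesnaviciusOffClosed_of_F_of_resolutionFull`). [OURS · conditional-result]
[cite: Temkin2008, Prop. 2.3.4; Lemma 2.1.4] [cite: CossartPiltant2019, Thm. 1.1; Prop. 4.4] [cite: Cesnavicius2021, Thm. 5.3] -/
theorem resolutionFullTr_le_of_prints_of_F_of_tStepF (n : ℕ)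
    (hG : CossartPiltant2019General.{0}) (hP : CossartPiltant2019Principalization.{0})
    (hM : CesnaviciusBlowupMacaulayficationOffClosed.{0}) {p : ℕ} (hp : p.Prime)
    (hF : ∀ e : ℕ, 4 ≤ e → e ≤ n → ∀ (k : Type) [Field k] [CharP k p] (X : Scheme.{0}) (f : X ⟶ Spec (.of k)),
      IsSeparated f → LocallyOfFiniteType f → QuasiCompact f → IsIntegral X →
      ∀ x : X, IsClosed ({x} : Set X) → x ∉ Scheme.regularLocus X → ringKrullDim (X.presheaf.stalk x) = e →
      ∀ (S' : Scheme.{0}) (g : S' ⟶ Spec (X.presheaf.stalk x)) (I : (Spec (X.presheaf.stalk x)).IdealSheafData),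
        I ≠ ⊥ → (I.support : Set (Spec (X.presheaf.stalk x))) ⊆ (Scheme.regularLocus (Spec (X.presheaf.stalk x)))ᶜ → IsBlowup g I →
        (∀ s : S', g.base s ≠ closedPoint (X.presheaf.stalk x) → s ∈ Scheme.regularLocus S') →
        (∀ s : S', CMCl (S'.presheaf.stalk s)) →
        ∃ 𝓚 : S'.IdealSheafData, 𝓚 ≠ ⊥ ∧ (∀ s ∈ (𝓚.support : Set S'), g.base s = closedPoint (X.presheaf.stalk x)) ∧
          ∀ (S'' : Scheme.{0}) (π : S'' ⟶ S'), IsBlowup π 𝓚 → ∀ s : S'', FullCl p (S''.presheaf.stalk s))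
    (hT : ∀ e r : ℕ, 4 ≤ e → e ≤ n → 1 ≤ r → LocalRegularizationFibreFullTr p e r) :
    ∀ e r : ℕ, 4 ≤ e → e ≤ n → 1 ≤ r → ResolutionFullTr p e r := by
  induction n using Nat.strong_induction_on with
  | _ n ih =>
    intro e r h4 hen hr
    -- the lower T-levels `4 ≤ e′ < e` from the lower ResolutionFull-levels (square) — available by the induction hypothesis at `n := e − 1`
    have hRlt : ∀ e' r' : ℕ, 4 ≤ e' → e' + 1 ≤ e → 1 ≤ r' → ClosedPointLocalResolutionAdmTr p e' r' := by
      intro e' r' h4' hlt hr'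
      refine tr_le_of_cesnaviciusOffClosed_of_F_of_resolutionFullF (e - 1) hG hP hM hp (fun m hm hme => hF m hm (by omega))
        (fun m r'' hm hme hr'' => ih (e - 1) (by omega) (fun m' hm' hm'e => hF m' hm' (by omega)) (fun m' r₃ hm' hm'e hr₃ => hT m' r₃ hm' (by omega) hr₃)
          m r'' hm hme hr'') e' r' h4' (by omega) hr'
    exact resolutionFullTr_of_cm_of_F_of_tStepF h4 hG hP (DimSliceOfCesnavicius.cmSupplier_of_cesnaviciusOffClosed hM) hp hRlt (hF e h4 hen) (hT e r h4 hen hr)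


/-- ★★★ **THE ROUTE DECL ⟸ {CP 2019 Thm 1.1, Stacks 081R, CP 2019 Prop 4.4, Česnavičius 2021 Thm 5.3 (B)} BY NAME ∧ the «CM ⇒ FULL» fibre-local step `LocalFInjectivizationFibreAdmGe4` ∧
the «FULL ⇒ REGULAR» fibre-local step {T″(p,e,r)}_{p prime, e ≥ 4, r ≥ 1}.** [OURS · conditional-result: conditional on four published theorems BY NAME and on the CANDIDATE statements]
[cite: Cesnavicius2021, Thm. 5.3] [cite: CossartPiltant2019, Thm. 1.1 (i)(ii); Prop. 4.4] [cite: Temkin2008, Prop. 2.3.4] -/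
theorem fInjectiveMacaulayfication_of_prints_of_LFadmF_of_tStepF
    (hG : CossartPiltant2019General.{0}) (hP : CossartPiltant2019Principalization.{0})
    (hM : CesnaviciusBlowupMacaulayficationOffClosed.{0})
    (hLF : LocalFullificationFibreAdmGe4Split.LocalFInjectivizationFibreAdmGe4)
    (hT : ∀ p e r : ℕ, p.Prime → 4 ≤ e → 1 ≤ r → LocalRegularizationFibreFullTr p e r) :
    Summit.ResolutionOfSingularities.ResolutionOfSingularities.Theses.FrobeniusLadder.FInjectiveMacaulayfication :=
  fInjectiveMacaulayfication_of_cesnaviciusOffClosed_of_LFadmF_of_resolutionFullF hG hP hM hLF fun p e r hp he hr =>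
    resolutionFullTr_le_of_prints_of_F_of_tStepF e hG hP hM hp (fun e' h4 _ => hLF e' h4 p hp) (fun e' r' h4' _ hr' => hT p e' r' hp h4' hr') e r he le_rfl hr


/-- ★★★ **The same at ONE transcendental: crux ⟸ four prints ∧ [CM ⇒ FULL step] ∧ [FULL ⇒ REGULAR step {T″(p,e,1)}_{p prime, e ≥ 4}]** — the v41 «FULL-TO-REGULAR DOOR» `_of` term
BY NAME. [OURS · conditional-result] [cite: Cesnavicius2021, Thm. 5.3] [cite: CossartPiltant2019, Thm. 1.1 (i)(ii); Prop. 4.4] [cite: Temkin2008, Prop. 2.3.4] -/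
theorem fInjectiveMacaulayfication_of_prints_of_LFadmF_of_tStepOneF
    (hG : CossartPiltant2019General.{0}) (hP : CossartPiltant2019Principalization.{0})
    (hM : CesnaviciusBlowupMacaulayficationOffClosed.{0})
    (hLF : LocalFullificationFibreAdmGe4Split.LocalFInjectivizationFibreAdmGe4)
    (hT1 : ∀ p e : ℕ, p.Prime → 4 ≤ e → LocalRegularizationFibreFullTr p e 1) :
    Summit.ResolutionOfSingularities.ResolutionOfSingularities.Theses.FrobeniusLadder.FInjectiveMacaulayfication :=
  fInjectiveMacaulayfication_of_prints_of_LFadmF_of_tStepF hG hP hM hLF fun p e r hp he hr => forall_tStep_of_one (hT1 p e hp he) r hr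

/-! ## §1b Twins of the recipe-tower door terms (v42/v44 shapes) -/
/-- crux ⟸ THREE printed hypotheses ∧ (some Sing-supported recipe's tower terminates) ∧ T″(p,e,1) — flattening-free twin of
`IntrinsicTower.Recipes.fInjectiveMacaulayfication_of_prints_of_tower_of_tStepOne`. [OURS · conditional] -/
theorem fInjectiveMacaulayfication_of_prints_of_tower_of_tStepOneF (c : CentreRecipe) (hc : SingSupported c)
    (hG : CossartPiltant2019General.{0}) (hP : CossartPiltant2019Principalization.{0})
    (hM : CesnaviciusBlowupMacaulayficationOffClosed.{0})
    (hTT : TowerTerminates c)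
    (hT1 : ∀ p e : ℕ, p.Prime → 4 ≤ e → TrFullStep.LocalRegularizationFibreFullTr p e 1) :
    Summit.ResolutionOfSingularities.ResolutionOfSingularities.Theses.FrobeniusLadder.FInjectiveMacaulayfication :=
  fInjectiveMacaulayfication_of_prints_of_LFadmF_of_tStepOneF hG hP hM
    (localFInjectivizationFibreAdmGe4_of_towerTerminates c hc hTT) hT1

/-- crux ⟸ THREE printed hypotheses ∧ (SF) ∧ (RR-Sing at `r = 1`, every `e ≥ 4`) — flattening-free twin of `RegTower.fInjectiveMacaulayfication_of_prints_of_singTowers` (the HELD line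
v44's door term). [OURS · conditional] -/
theorem fInjectiveMacaulayfication_of_prints_of_singTowersF
    (hG : CossartPiltant2019General.{0}) (hP : CossartPiltant2019Principalization.{0})
    (hM : CesnaviciusBlowupMacaulayficationOffClosed.{0})
    (hSF : SingFullTowerConjecture)
    (hRR : ∀ p e : ℕ, p.Prime → 4 ≤ e → SingTowerConjecture p e 1) :
    Summit.ResolutionOfSingularities.ResolutionOfSingularities.Theses.FrobeniusLadder.FInjectiveMacaulayfication :=
  fInjectiveMacaulayfication_of_prints_of_tower_of_tStepOneF singCentre singSupported_singCentre hG hP hM hSF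
    (fun p e hp he => tStep_of_singTowerConjecture (hRR p e hp he))

/-! ## §2 ★★ The v41 door on TWO prints -/
/-- ★★ **THE v41 «FULL-TO-REGULAR» DOOR ON TWO PRINTED HYPOTHESES**: crux ⟸ Cossart–Piltant 2019 Thm 1.1 (`hG`) ∧ Česnavičius 2021 Thm 5.3-(B) (`hM`) ∧ the F-half ∧ T″(p,e,1), e ≥ 4 —
Cossart–Piltant 2019 Prop 4.4 supplied by the tree theorem `CP2008Prop44.CossartPiltant2019Principalization_holds` (F-77), Raynaud–Gruson flattening (F-76) no longer an input.
Same research stubs as the registered door; only the named-fact bundle shrank. [OURS · conditional-result] -/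
theorem fInjectiveMacaulayfication_of_twoPrints_of_LFadmF_of_tStepOne
    (hG : CossartPiltant2019General.{0}) (hM : CesnaviciusBlowupMacaulayficationOffClosed.{0})
    (hLF : LocalFullificationFibreAdmGe4Split.LocalFInjectivizationFibreAdmGe4)
    (hT1 : ∀ p e : ℕ, p.Prime → 4 ≤ e → LocalRegularizationFibreFullTr p e 1) :
    Summit.ResolutionOfSingularities.ResolutionOfSingularities.Theses.FrobeniusLadder.FInjectiveMacaulayfication :=
  fInjectiveMacaulayfication_of_prints_of_LFadmF_of_tStepOneF hG
    Summit.ResolutionOfSingularities.ResolutionOfSingularities.Theorems.CP2008Prop44.CossartPiltant2019Principalization_holds.{0} hM hLF hT1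

/-- The same with the T-step at every transcendence degree `r ≥ 1` (the shape of `TrFullStepDoor.fInjectiveMacaulayfication_of_prints_of_LFadmF_of_tStep`). [OURS · conditional-result] -/
theorem fInjectiveMacaulayfication_of_twoPrints_of_LFadmF_of_tStep
    (hG : CossartPiltant2019General.{0}) (hM : CesnaviciusBlowupMacaulayficationOffClosed.{0})
    (hLF : LocalFullificationFibreAdmGe4Split.LocalFInjectivizationFibreAdmGe4)
    (hT : ∀ p e r : ℕ, p.Prime → 4 ≤ e → 1 ≤ r → LocalRegularizationFibreFullTr p e r) :
    Summit.ResolutionOfSingularities.ResolutionOfSingularities.Theses.FrobeniusLadder.FInjectiveMacaulayfication :=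
  fInjectiveMacaulayfication_of_prints_of_LFadmF_of_tStepF hG
    Summit.ResolutionOfSingularities.ResolutionOfSingularities.Theorems.CP2008Prop44.CossartPiltant2019Principalization_holds.{0} hM hLF hT

/-- **THE HELD LINE v44's DOOR ON TWO PRINTS**: crux ⟸ CP 2019 Thm 1.1 ∧ Česnavičius 5.3-(B) ∧ `RegTower.SingFullTowerConjecture` ∧ `RegTower.SingTowerConjecture p e 1` (e ≥ 4) — both tower
statements OUR candidates, HELD. [OURS · conditional-result] -/
theorem fInjectiveMacaulayfication_of_twoPrints_of_singTowers
    (hG : CossartPiltant2019General.{0}) (hM : CesnaviciusBlowupMacaulayficationOffClosed.{0})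
    (hSF : SingFullTowerConjecture) (hRR : ∀ p e : ℕ, p.Prime → 4 ≤ e → SingTowerConjecture p e 1) :
    Summit.ResolutionOfSingularities.ResolutionOfSingularities.Theses.FrobeniusLadder.FInjectiveMacaulayfication :=
  fInjectiveMacaulayfication_of_prints_of_singTowersF hG
    Summit.ResolutionOfSingularities.ResolutionOfSingularities.Theorems.CP2008Prop44.CossartPiltant2019Principalization_holds.{0} hM hSF hRR

end Summit.ResolutionOfSingularities.ResolutionOfSingularities.Theorems.FInjectiveMacaulayfication.StacksFree

end
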